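import Summits.BirchSwinnertonDyer.BirchSwinnertonDyer.Theses.GenusKolyvaginAtTwo
import Summits.BirchSwinnertonDyer.BirchSwinnertonDyer.Theorems.ByReductionTypeAtTwoTwoTorsionIsogenyPairs
import Summits.BirchSwinnertonDyer.BirchSwinnertonDyer.Theorems.ByReductionTypeAtTwoMultTransportTwoIsogenyNormalForm
import Summits.BirchSwinnertonDyer.BirchSwinnertonDyer.Theorems.TwoAdicConverseFullTwoTorsionRamified
import HarnessLib

/-!
# LINE 45 «real_leaf» (ideator bsd-idea-1, g32) — crux `GenusKolyvaginAtTwo.RankOneTwoTorsionResidualAtTwo` (R″, item 27478)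

**FULL rational `2`-torsion is never the obstruction to `BSD₂` in analytic rank one.**  KERNEL THEOREM of this line
(`fullTwoTorsionResidual_of_cyclic`, sorry-free): modulo PRINT {GZK `rank = r_an ≤ 1`, Cassels' isogeny invariance,
modularity}, `BSD(W, 2)` for every globally minimal non-CM `W/ℚ` with `r_an(W) = 1` and `W(ℚ)[2] ≅ (ℤ/2)²` FOLLOWS from
`BSD(·, 2)` on the globally minimal non-CM rank-one curves with CYCLIC non-trivial rational `2`-torsion.

## The lever (real-place / sign RIGIDITY; technique card «compactness–contradiction / rigidity»)

Let `x₁, x₂, x₃` be the three rational `2`-torsion abscissae of `W` (roots of `4X³ + b₂X² + 2b₄X + b₆`).  Putting `W` in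
two-torsion normal form at `(xᵢ, yᵢ)` (tree `exists_variableChange_twoTorsionNF`) gives `Y² = X³ + aᵢX² + bᵢX` with
`bᵢ = 3xᵢ² + (b₂/2)xᵢ + b₄/2`, and Vieta (tree `vieta_of_three_twoTorsion_roots`) gives **`bᵢ = (xᵢ − xⱼ)(xᵢ − xₖ)`**, hence

  `b₁ · b₂ · b₃ = −((x₁ − x₂)(x₁ − x₃)(x₂ − x₃))² < 0`.

So the three `bᵢ` are NEVER all rational squares (`sign_rigidity_not_all_isSquare`): for some `i`, `bᵢ ∉ ℚ²`, and then the
`2`-isogenous partner `W/⟨Tᵢ⟩ : Y² = X³ − 2aᵢX² + (aᵢ² − 4bᵢ)X` has EXACTLY ONE rational point of order `2` (tree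
`hasUniqueRationalTwoTorsionX_twoIsogenyCodomain_zero_iff`).  Its globally minimal model `W′` (Néron,
`hasGlobalMinimalModel_rat_holds`) is non-CM, has `r_an(W′) = r_an(W) = 1` (tree `hasCM_iff_of_twoTorsionPair`,
`analyticRank_eq_of_twoTorsionPair`), carries non-trivial CYCLIC rational `2`-torsion, and `BSD(W,2) ⟺ BSD(W′,2)` along the
`ℤ/2`-linked pair (tree `bsdp_two_iff_of_twoTorsionPair`: GZK + Cassels + modularity).  (Over `ℝ` this is the statement that
exactly one or three of the `Tᵢ` lie on the identity component; the proof here is three lines of `ℚ`-algebra.)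

## Composition (kernel-checked, BY NAME)

  `R″ ⟸ PRINT(GZK ∧ Cassels ∧ modularity) + CYC`,   `CYC := CyclicTwoTorsionRankOneAtTwo` (R″ restricted to cyclic
  rational `2`-torsion) — `RankOneTwoTorsionResidualAtTwo_of`.

Consequence for LINE 44 «shu_zhai_cell» (same crux): its research stub RES-A `FullTwoTorsionRankOneResidualAtTwo` is
DERIVED (`fullTwoTorsionResidual_of_cyclic` below proves `PRINT → CYC → RES-A`); merged, R″'s beyond-print set is LINE 44's
RES-B′ `CyclicTwoTorsionOffIsogenyCellResidualAtTwo` ALONE (the Shu–Zhai isogeny cell being closed there modulo WALL + print).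

HONEST FRAMING.  No summit is proved by a line.  `CYC` is OPEN research (reducible `E[2]`, rank one, `p = 2`: no Euler-system
argument in print off the Shu–Zhai cell); PRINT is three named printed facts (nothing asserted by the tree).  What is PROVED here
is the reduction full ⟹ cyclic, unconditionally in the kernel modulo those three named facts.

References: [SilvermanAEC2009] III.1 Table 3.1, III.2.3 (ψ₂), III.4 Ex. 4.5, X.4 Prop. 4.9; [Cassels1965ArithmeticVIII];
[MilneADT2006] Thm. I.7.3; [GrossZagier1986]; [Kolyvagin1990]; [BCDTJAMS2001].
-/

set_option autoImplicit false
set_option linter.dupNamespace false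

noncomputable section

open scoped Classical
open WeierstrassCurve Literature Literature.NumberTheory.EllipticCurves
  Literature.NumberTheory.EllipticCurves.Rank1Residual
  Literature.NumberTheory.EllipticCurves.Rank1Residual.Typed
  Literature.NumberTheory.EllipticCurves.Greenberg1999
  Summit.BirchSwinnertonDyer.BirchSwinnertonDyer.Theses.GenusKolyvaginAtTwo
  Summit.BirchSwinnertonDyer.BirchSwinnertonDyer.Theorems.TwoAdicOffHabitat
  Summit.BirchSwinnertonDyer.BirchSwinnertonDyer.Theorems.TwoAdicTwistConverse
  Summit.BirchSwinnertonDyer.BirchSwinnertonDyer.Theorems.MultTransportTwistedDescent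

namespace Summit.BirchSwinnertonDyer.BirchSwinnertonDyer.Cruxes.RankOneTwoTorsionResidualAtTwo.RealLeaf

/-! ## §0 Definitions (texts identical to LINE 44 «shu_zhai_cell», so the items coincide on merge) -/

/-- **Cyclic rational `2`-torsion**: at most ONE non-zero rational point killed by `2` (`W(ℚ)[2] ⊆ ℤ/2`).  Its negation is
FULL rational `2`-torsion `(ℤ/2)²` (`exists_three_abscissae_of_not_hasCyclic`). -/
def HasCyclicRationalTwoTorsion (W : WeierstrassCurve ℚ) : Prop :=
  ∀ P Q : W.toAffine.Point, 2 • P = 0 → 2 • Q = 0 → P ≠ 0 → Q ≠ 0 → P = Q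

/-- **RES-A of LINE 44 — FULL rational `2`-torsion, rank one, non-CM ⟹ BSD₂** (DERIVED in this file, no longer a stub). -/
def FullTwoTorsionRankOneResidualAtTwo : Prop :=
  ∀ (W : WeierstrassCurve ℚ) [W.IsElliptic] [W.IsGloballyMinimal],
    ¬ W.HasCM → W.analyticRank = 1 → (¬ ∀ P : W.toAffine.Point, 2 • P = 0 → P = 0) →
    ¬ HasCyclicRationalTwoTorsion W → BSDp W 2

/-- **CYC — R″ on CYCLIC rational `2`-torsion** (research; beyond print off the Shu–Zhai isogeny cell): for every globally
minimal non-CM `W/ℚ` with `r_an(W) = 1` and `W(ℚ)[2] ≅ ℤ/2`, `BSD(W, 2)`.  Why it might fail to be provable soon: reducible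
`E[2]` — no error-free Kolyvagin bound at `2` in print (Matar–Nekovář 2019 §0.10 vs Lawson–Wuthrich 2016); the printed
supply is Shu–Zhai 2021 Thms 1.2/1.4 (LINE 44's cell) only. -/
def CyclicTwoTorsionRankOneAtTwo : Prop :=
  ∀ (W : WeierstrassCurve ℚ) [W.IsElliptic] [W.IsGloballyMinimal],
    ¬ W.HasCM → W.analyticRank = 1 → (¬ ∀ P : W.toAffine.Point, 2 • P = 0 → P = 0) →
    HasCyclicRationalTwoTorsion W → BSDp W 2

/-! ## §1 The registered stubs (the ONLY sorries of this file) -/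

/-- PRINT — Gross–Zagier–Kolyvagin `rank = r_an` for `r_an ≤ 1`, Cassels' isogeny invariance of the BSD quotient, and the
modularity of `E/ℚ`, AS PRINTED (tree named facts `rank_eq_analyticRank_of_analyticRank_le_one`, `bsdRHS_eq_of_isIsogenous`,
`hasEntireLFunction_rat`; nothing asserted by the tree).  [cite: GrossZagier1986] [cite: Kolyvagin1990]
[cite: Cassels1965ArithmeticVIII] [cite: MilneADT2006, Thm. I.7.3] [cite: BCDTJAMS2001, Thm. A] -/
theorem stub_printGZKCasselsModularity :
    rank_eq_analyticRank_of_analyticRank_le_one ∧ bsdRHS_eq_of_isIsogenous ∧ hasEntireLFunction_rat := by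
  sorry

/-- CYC (research). -/
theorem stub_cyclicTwoTorsionRankOne : CyclicTwoTorsionRankOneAtTwo := by
  sorry

/-! ## §2 Kernel-checked: points of order two and their abscissae -/

section Points

variable {W : WeierstrassCurve ℚ}

/-- A non-zero rational point killed by `2` is an affine point `(x, y)` with `2y + a₁x + a₃ = 0`.
[cite: SilvermanAEC2009, III.2.3] -/
theorem exists_xy_of_two_nsmul_eq_zero {P : W.toAffine.Point} (hP0 : P ≠ 0) (h2 : 2 • P = 0) :
    ∃ (x y : ℚ) (h : W.toAffine.Nonsingular x y), P = .some x y h ∧ 2 * y + W.a₁ * x + W.a₃ = 0 := by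
  rcases P with _ | ⟨x, y, hns⟩
  · exact absurd rfl hP0
  · refine ⟨x, y, hns, rfl, ?_⟩
    by_contra hy'
    have hy : y ≠ W.toAffine.negY x y := by
      intro h
      apply hy'
      rw [WeierstrassCurve.Affine.negY] at h
      linear_combination h
    rw [two_nsmul, WeierstrassCurve.Affine.Point.add_self_of_Y_ne hy] at h2
    exact WeierstrassCurve.Affine.Point.some_ne_zero _ h2

/-- A rational point of order `2` is determined by its abscissa (`y = −(a₁x + a₃)/2`). [cite: SilvermanAEC2009, III.2.3] -/
theorem some_eq_some_of_two_torsion {x y₁ y₂ : ℚ} (h₁ : W.toAffine.Nonsingular x y₁) (h₂ : W.toAffine.Nonsingular x y₂)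
    (e₁ : 2 * y₁ + W.a₁ * x + W.a₃ = 0) (e₂ : 2 * y₂ + W.a₁ * x + W.a₃ = 0) :
    (WeierstrassCurve.Affine.Point.some x y₁ h₁ : W.toAffine.Point) = .some x y₂ h₂ := by
  have hy : y₁ = y₂ := by linarith
  subst hy
  rfl

/-- **`(ℤ/2)² ⊆ W(ℚ)` ⟹ three pairwise distinct rational `2`-torsion abscissae** (the tree's spelling of «full rational
`2`-torsion», e.g. in `matsuno2008_prop62_lambda_fullTwoTorsion_two`): two distinct non-zero points `P, Q` killed by `2`
and their sum.  [cite: SilvermanAEC2009, III.2.3] -/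
theorem exists_three_abscissae_of_not_hasCyclic (hfull : ¬ HasCyclicRationalTwoTorsion W) :
    ∃ x₁ x₂ x₃ : ℚ, x₁ ≠ x₂ ∧ x₁ ≠ x₃ ∧ x₂ ≠ x₃ ∧ HasRationalTwoTorsionX W x₁ ∧
      HasRationalTwoTorsionX W x₂ ∧ HasRationalTwoTorsionX W x₃ := by
  unfold HasCyclicRationalTwoTorsion at hfull
  push Not at hfull
  obtain ⟨P, Q, h2P, h2Q, hP0, hQ0, hPQ⟩ := hfull
  -- the third point `R = P + Q`
  have hnegP : -P = P := by
    rw [neg_eq_iff_add_eq_zero, ← two_nsmul]; exact h2P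
  have h2R : 2 • (P + Q) = 0 := by rw [nsmul_add, h2P, h2Q, add_zero]
  have hR0 : P + Q ≠ 0 := by
    intro h
    have hQ : Q = -P := eq_neg_of_add_eq_zero_right h
    rw [hnegP] at hQ
    exact hPQ hQ.symm
  have hRP : P + Q ≠ P := fun h ↦ hQ0 (add_left_cancel (h.trans (add_zero P).symm))
  have hRQ : P + Q ≠ Q := fun h ↦ hP0 (add_right_cancel (h.trans (zero_add Q).symm))
  obtain ⟨xP, yP, hP, rfl, eP⟩ := exists_xy_of_two_nsmul_eq_zero hP0 h2P
  obtain ⟨xQ, yQ, hQ, rfl, eQ⟩ := exists_xy_of_two_nsmul_eq_zero hQ0 h2Q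
  obtain ⟨xR, yR, hR, hReq, eR⟩ := exists_xy_of_two_nsmul_eq_zero hR0 h2R
  refine ⟨xP, xQ, xR, ?_, ?_, ?_, ⟨yP, hP.left, eP⟩, ⟨yQ, hQ.left, eQ⟩, ⟨yR, hR.left, eR⟩⟩
  · rintro rfl
    exact hPQ (some_eq_some_of_two_torsion hP hQ eP eQ)
  · rintro rfl
    exact hRP (hReq.trans (some_eq_some_of_two_torsion hR hP eR eP))
  · rintro rfl
    exact hRQ (hReq.trans (some_eq_some_of_two_torsion hR hQ eR eQ))

/-- Conversely, a UNIQUE rational `2`-torsion abscissa means cyclic rational `2`-torsion. [cite: SilvermanAEC2009, III.2.3] -/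
theorem hasCyclic_of_hasUniqueRationalTwoTorsionX {x : ℚ} (h : HasUniqueRationalTwoTorsionX W x) :
    HasCyclicRationalTwoTorsion W := by
  intro P Q h2P h2Q hP0 hQ0
  obtain ⟨xP, yP, hP, rfl, eP⟩ := exists_xy_of_two_nsmul_eq_zero hP0 h2P
  obtain ⟨xQ, yQ, hQ, rfl, eQ⟩ := exists_xy_of_two_nsmul_eq_zero hQ0 h2Q
  have hxP : xP = x := h.2 xP ⟨yP, hP.left, eP⟩
  have hxQ : xQ = x := h.2 xQ ⟨yQ, hQ.left, eQ⟩
  subst hxP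
  subst hxQ
  exact some_eq_some_of_two_torsion hP hQ eP eQ

end Points

/-! ## §3 Kernel-checked: SIGN RIGIDITY — the three normal-form coefficients are never all squares -/

/-- **Sign rigidity.**  For three pairwise distinct rational `2`-torsion abscissae `x₁, x₂, x₃` of `W`, the normal-form
coefficients `bᵢ = 3xᵢ² + (b₂/2)xᵢ + b₄/2 = (xᵢ − xⱼ)(xᵢ − xₖ)` have product `−((x₁−x₂)(x₁−x₃)(x₂−x₃))² < 0`; hence NOT all
three are squares in `ℚ`.  [cite: SilvermanAEC2009, III.2.3 (ψ₂) and III.4 Ex. 4.5] -/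
theorem sign_rigidity_not_all_isSquare (W : WeierstrassCurve ℚ) {x₁ x₂ x₃ : ℚ} (h12 : x₁ ≠ x₂) (h13 : x₁ ≠ x₃)
    (h23 : x₂ ≠ x₃) (h₁ : HasRationalTwoTorsionX W x₁) (h₂ : HasRationalTwoTorsionX W x₂)
    (h₃ : HasRationalTwoTorsionX W x₃) :
    ∃ x : ℚ, HasRationalTwoTorsionX W x ∧ ¬ IsSquare (3 * x ^ 2 + W.b₂ / 2 * x + W.b₄ / 2) := by
  obtain ⟨y₁, hE₁, e₁⟩ := h₁
  obtain ⟨y₂, hE₂, e₂⟩ := h₂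
  obtain ⟨y₃, hE₃, e₃⟩ := h₃
  obtain ⟨hS, hS₂, -⟩ := vieta_of_three_twoTorsion_roots (fourXCubed_add_eq_zero_of_twoTorsion hE₁ e₁)
    (fourXCubed_add_eq_zero_of_twoTorsion hE₂ e₂) (fourXCubed_add_eq_zero_of_twoTorsion hE₃ e₃) h12 h13 h23
  by_contra hall
  push Not at hall
  obtain ⟨r₁, hr₁⟩ := hall x₁ ⟨y₁, hE₁, e₁⟩
  obtain ⟨r₂, hr₂⟩ := hall x₂ ⟨y₂, hE₂, e₂⟩
  obtain ⟨r₃, hr₃⟩ := hall x₃ ⟨y₃, hE₃, e₃⟩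
  -- the product of the three coefficients is minus a non-zero square
  have hD : (x₁ - x₂) * (x₁ - x₃) * (x₂ - x₃) ≠ 0 :=
    mul_ne_zero (mul_ne_zero (sub_ne_zero.mpr h12) (sub_ne_zero.mpr h13)) (sub_ne_zero.mpr h23)
  have hprod : (3 * x₁ ^ 2 + W.b₂ / 2 * x₁ + W.b₄ / 2) * (3 * x₂ ^ 2 + W.b₂ / 2 * x₂ + W.b₄ / 2) *
      (3 * x₃ ^ 2 + W.b₂ / 2 * x₃ + W.b₄ / 2) = -(((x₁ - x₂) * (x₁ - x₃) * (x₂ - x₃)) ^ 2) := by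
    have eb₂ : W.b₂ = -4 * (x₁ + x₂ + x₃) := by linear_combination hS
    have eb₄ : W.b₄ = 2 * (x₁ * x₂ + x₁ * x₃ + x₂ * x₃) := by linear_combination (-(1 : ℚ) / 2) * hS₂
    rw [eb₂, eb₄]; ring
  have hpos : 0 < ((x₁ - x₂) * (x₁ - x₃) * (x₂ - x₃)) ^ 2 := by positivity
  have hsq : 0 ≤ (r₁ * r₂ * r₃) * (r₁ * r₂ * r₃) := mul_self_nonneg _
  have hprod' : (3 * x₁ ^ 2 + W.b₂ / 2 * x₁ + W.b₄ / 2) * (3 * x₂ ^ 2 + W.b₂ / 2 * x₂ + W.b₄ / 2) *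
      (3 * x₃ ^ 2 + W.b₂ / 2 * x₃ + W.b₄ / 2) = (r₁ * r₂ * r₃) * (r₁ * r₂ * r₃) := by
    rw [hr₁, hr₂, hr₃]; ring
  rw [hprod'] at hprod
  linarith

/-! ## §4 Kernel-checked: the CYCLIC PARTNER and the transport -/

/-- **The cyclic partner.**  A curve with full rational `2`-torsion is in two-torsion normal form (after a change of variables
`C`) at a point `Tᵢ` whose normal-form coefficient `b = (C • W).a₄` is NOT a square; Silverman's `2`-isogeny quotient
`(C • W).twoIsogenyCodomain` then has EXACTLY ONE rational point of order `2`.  [cite: SilvermanAEC2009, III.4 Ex. 4.5, X.4 Prop. 4.9] -/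
theorem exists_partner_uniqueTwoTorsion (W : WeierstrassCurve ℚ) [W.IsElliptic] (hfull : ¬ HasCyclicRationalTwoTorsion W) :
    ∃ C : VariableChange ℚ, (C • W).IsTwoTorsionNF ∧ HasUniqueRationalTwoTorsionX (C • W).twoIsogenyCodomain 0 := by
  obtain ⟨x₁, x₂, x₃, h12, h13, h23, h₁, h₂, h₃⟩ := exists_three_abscissae_of_not_hasCyclic hfull
  obtain ⟨x₀, ⟨y₀, hEq, h2⟩, hnsq⟩ := sign_rigidity_not_all_isSquare W h12 h13 h23 h₁ h₂ h₃
  obtain ⟨C, hNF, -, -, -, ha₄⟩ := exists_variableChange_twoTorsionNF W hEq h2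
  haveI := hNF
  refine ⟨C, hNF, ?_⟩
  rw [hasUniqueRationalTwoTorsionX_twoIsogenyCodomain_zero_iff (C • W), ha₄]
  exact hnsq

/-- **RES-A IS DERIVED: full ⟹ cyclic** (the theorem of this line).  Modulo PRINT {GZK, Cassels, modularity}: if `BSD(·,2)`
holds on the globally minimal non-CM rank-one curves with cyclic non-trivial rational `2`-torsion, it holds on those with full
rational `2`-torsion — pass to the globally minimal model `W′` of the cyclic partner (`r_an`, CM are isogeny invariants; the
unique rational `2`-torsion abscissa moves along the change of variables) and transport `BSD₂` back along the `ℤ/2`-linked pair.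
[cite: MilneADT2006, Thm. I.7.3] [cite: Cassels1965ArithmeticVIII] [cite: SilvermanAEC2009, III.4 Ex. 4.5] -/
theorem fullTwoTorsionResidual_of_cyclic (hGZK : rank_eq_analyticRank_of_analyticRank_le_one)
    (hCassels : bsdRHS_eq_of_isIsogenous) (hmod : hasEntireLFunction_rat) (hcyc : CyclicTwoTorsionRankOneAtTwo) :
    FullTwoTorsionRankOneResidualAtTwo := by
  intro W _ _ hCM hr hT hfull
  obtain ⟨C, hNF, huniq⟩ := exists_partner_uniqueTwoTorsion W hfull
  haveI := hNF
  obtain ⟨C₀, hmin⟩ := hasGlobalMinimalModel_rat_holds (C • W).twoIsogenyCodomain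
  set W' : WeierstrassCurve ℚ := C₀ • (C • W).twoIsogenyCodomain with hW'
  haveI : W'.IsGloballyMinimal := hmin
  have hlink : C₀⁻¹ • W' = (C • W).twoIsogenyCodomain := inv_smul_smul C₀ _
  have hCM' : ¬ W'.HasCM := fun h ↦ hCM ((hasCM_iff_of_twoTorsionPair hlink).mpr h)
  have hr' : W'.analyticRank = 1 := (analyticRank_eq_of_twoTorsionPair hlink) ▸ hr
  have huniq' : HasUniqueRationalTwoTorsionX W' (C₀.toX 0) :=
    (hasUniqueRationalTwoTorsionX_smul_toX_iff (C • W).twoIsogenyCodomain C₀ 0).mpr huniq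
  have hT' : ¬ ∀ P : W'.toAffine.Point, 2 • P = 0 → P = 0 := by
    obtain ⟨P, hP0, h2P⟩ := (exists_two_torsion_iff_exists_hasRationalTwoTorsionX W').mpr ⟨_, huniq'.1⟩
    exact fun h ↦ hP0 (h P h2P)
  have h' : BSDp W' 2 := hcyc W' hCM' hr' hT' (hasCyclic_of_hasUniqueRationalTwoTorsionX huniq')
  exact (bsdp_two_iff_of_twoTorsionPair hGZK hCassels hmod hlink hr.le).mpr h'

/-! ## §5 Kernel-checked: the carve and the crux BY NAME -/

/-- **R″ from PRINT + CYC**: split on cyclic vs full rational `2`-torsion; the full case is §4. -/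
theorem residual_of_cyclic
    (hP : rank_eq_analyticRank_of_analyticRank_le_one ∧ bsdRHS_eq_of_isIsogenous ∧ hasEntireLFunction_rat)
    (hcyc : CyclicTwoTorsionRankOneAtTwo) : RankOneTwoTorsionResidualAtTwo := by
  intro W _ _ hcm hr hT
  by_cases h : HasCyclicRationalTwoTorsion W
  · exact hcyc W hcm hr hT h
  · exact fullTwoTorsionResidual_of_cyclic hP.1 hP.2.1 hP.2.2 hcyc W hcm hr hT h

/-- **The crux BY NAME** (proof-of-item shape): `GenusKolyvaginAtTwo.RankOneTwoTorsionResidualAtTwo` from the two registered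
stubs.  OPEN mathematics lives in `stub_cyclicTwoTorsionRankOne` only. -/
theorem RankOneTwoTorsionResidualAtTwo_of : RankOneTwoTorsionResidualAtTwo :=
  residual_of_cyclic stub_printGZKCasselsModularity stub_cyclicTwoTorsionRankOne

end Summit.BirchSwinnertonDyer.BirchSwinnertonDyer.Cruxes.RankOneTwoTorsionResidualAtTwo.RealLeaf

end
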